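import Literature.Geometry.Lorentzian.KerrEquatorialCalculus
import HarnessLib

/-!
# The geodesic equation along the equatorial circular photon orbits of Kerr, pointwise
(family `gr`; namespace `Literature.Geometry.Lorentzian.Kerr`)

For `0 < M`, `0 ≤ a ≤ M` the retrograde equatorial circular photon orbit of the Kerr spacetime has
Boyer–Lindquist (= Kerr–Schild) radius `r₀ ∈ [3M, 4M]`, the largest root of
`r (r − 3M)² = 4a²M` (Bardeen–Press–Teukolsky 1972; Chandrasekhar 1983, §63(c); Sbierski, Anal.
PDE 8 (2015), §7A: the endpoint `r_ρ` of the photon region `[r_δ, r_ρ]`;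
`Kerr.exists_photonRadius`).
Through a point `p = (t, x, y, 0)` of the circle `x² + y² = r₀² + a²` of the equatorial
hyperplane of the ingoing Kerr–Schild chart it has velocity `w = (1 − aq) ∂_t + q y ∂_x − q x ∂_y`
(`Kerr.orbitVel`; angular frequency `−q`, `q = √(M/r₀³)`) and coordinate acceleration
`−q²(x ∂_x + y ∂_y)` (`Kerr.orbitAcc`). This file proves the **geodesic equation at `p`**:
`c'' + Γ_p(c', c') = 0` for the Christoffel map `OpensChart.christoffel` of the Kerr–Schild
components `Kerr.bilin M a` (`Kerr.christoffel_orbitVel`), given only `q² r₀³ = M`.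

By nondegeneracy this is `2 g(c'', Z) + 2 ∂_{c'}G(c', Z) − ∂_Z G(c', c') = 0` for the four
coordinate vectors `Z` (`OpensChart.two_mul_val_christoffel`). The directional derivatives of the
components at `p` are the derivatives of the explicit one-variable functions of
`KerrEquatorialCalculus.lean` along the lines `p + s c'`, `p + s ∂_x`, `p + s ∂_y` (all inside the
hyperplane `{z = 0}`, where `r = √(x² + y² − a²)`, `H = M/r`), while `∂_t G = 0` (stationarity,
`Kerr.fderiv_bilin_basisVector_zero`) and `∂_z G_p(c', c') = 0` (reflection symmetry,
`Kerr.fderiv_bilin_basisVector_three_eq_zero`). After these substitutions the four identities are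
identities of rational functions in `x, y, r₀, a, q` (with `M = q² r₀³`), closed by
`field_simp; ring`. The curve itself, its nullity (where the orbit relation `2aq r₀ = r₀ − 3M`
enters) and the discharge of `Sbierski2015_kerr_trappedNullGeodesic` are in `KerrPhotonOrbit.lean`.

## References

* J. M. Bardeen, W. H. Press, S. A. Teukolsky, ApJ 178 (1972) 347, (2.18); S. Chandrasekhar,
  *The mathematical theory of black holes*, 1983, §63(c).
* J. Sbierski, Anal. PDE 8 (2015) 1379–1420, §7A (key `Sbierski2015`).
* B. O'Neill, *The geometry of Kerr black holes*, 1995, Ch. 4 (key `ONeill1995`); B. O'Neill,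
  *Semi-Riemannian geometry*, 1983, Ch. 3, Prop. 13 and Cor. 21 (key `ONeill1983`).
-/

noncomputable section

open Set Filter
open scoped Topology Manifold ContDiff

namespace Literature.Geometry.Lorentzian

namespace Kerr

/-! ### The photon radius -/

/-- **The retrograde photon radius**: for `0 < M`, `a² ≤ M²` the cubic `r(r − 3M)² − 4a²M`
has a root in `[3M, 4M]` (it is `≤ 0` at `3M` and `≥ 0` at `4M`). Bardeen–Press–Teukolsky 1972,
(2.18); Sbierski 2015, §7A (`r_ρ`). [cite: Sbierski2015, §7A] -/
theorem exists_photonRadius {M a : ℝ} (hM : 0 < M) (ha : a ^ 2 ≤ M ^ 2) :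
    ∃ r₀ : ℝ, 3 * M ≤ r₀ ∧ r₀ ≤ 4 * M ∧ r₀ * (r₀ - 3 * M) ^ 2 = 4 * a ^ 2 * M := by
  set f : ℝ → ℝ := fun r ↦ r * (r - 3 * M) ^ 2 - 4 * a ^ 2 * M with hf
  have hcont : ContinuousOn f (Icc (3 * M) (4 * M)) := by
    simp only [hf]; fun_prop
  have h3 : f (3 * M) ≤ 0 := by simp only [hf]; nlinarith [sq_nonneg a]
  have h4 : 0 ≤ f (4 * M) := by simp only [hf]; nlinarith
  obtain ⟨r₀, hr₀, hfr₀⟩ :=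
    intermediate_value_Icc (by linarith : 3 * M ≤ 4 * M) hcont ⟨h3, h4⟩
  refine ⟨r₀, hr₀.1, hr₀.2, ?_⟩
  simp only [hf] at hfr₀
  linarith

/-! ### Velocity and acceleration fields of the orbit through a point of `{z = 0}` -/

/-- The velocity of the photon orbit with frequency `−q` through the point `p` of the equatorial
hyperplane: `w = (1 − aq) ∂_t + q y ∂_x − q x ∂_y` (`ω = −q`, `e = 1 − aq`).
[cite: Sbierski2015, §7A] -/
def orbitVel (a q : ℝ) (p : E4) : E4 :=
  (1 - a * q) • E4.basisVector 0 + (q * p 2) • E4.basisVector 1 + (-(q * p 1)) • E4.basisVector 2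

/-- The (coordinate) acceleration of the photon orbit through `p`: `−q² (x ∂_x + y ∂_y)`
(centripetal). [cite: Sbierski2015, §7A] -/
def orbitAcc (q : ℝ) (p : E4) : E4 :=
  (-(q ^ 2 * p 1)) • E4.basisVector 1 + (-(q ^ 2 * p 2)) • E4.basisVector 2

/-- The `t*`-component of the velocity field. [folklore] -/
@[simp] theorem orbitVel_apply_zero (a q : ℝ) (p : E4) : orbitVel a q p 0 = 1 - a * q := by
  simp [orbitVel]

/-- The `x`-component of the velocity field. [folklore] -/
@[simp] theorem orbitVel_apply_one (a q : ℝ) (p : E4) : orbitVel a q p 1 = q * p 2 := by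
  simp [orbitVel]

/-- The `y`-component of the velocity field. [folklore] -/
@[simp] theorem orbitVel_apply_two (a q : ℝ) (p : E4) : orbitVel a q p 2 = -(q * p 1) := by
  simp [orbitVel]

/-- The `z`-component of the velocity field. [folklore] -/
@[simp] theorem orbitVel_apply_three (a q : ℝ) (p : E4) : orbitVel a q p 3 = 0 := by
  simp [orbitVel]

/-- The `t*`-component of the acceleration field. [folklore] -/
@[simp] theorem orbitAcc_apply_zero (q : ℝ) (p : E4) : orbitAcc q p 0 = 0 := by
  simp [orbitAcc]

/-- The `x`-component of the acceleration field. [folklore] -/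
@[simp] theorem orbitAcc_apply_one (q : ℝ) (p : E4) : orbitAcc q p 1 = -(q ^ 2 * p 1) := by
  simp [orbitAcc]

/-- The `y`-component of the acceleration field. [folklore] -/
@[simp] theorem orbitAcc_apply_two (q : ℝ) (p : E4) : orbitAcc q p 2 = -(q ^ 2 * p 2) := by
  simp [orbitAcc]

/-- The `z`-component of the acceleration field. [folklore] -/
@[simp] theorem orbitAcc_apply_three (q : ℝ) (p : E4) : orbitAcc q p 3 = 0 := by
  simp [orbitAcc]

/-! ### The geodesic equation at a point of the orbit -/

section Point

variable {M a r₀ q : ℝ} {p : E4}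

/-- On the orbit circle `x² + y² = r₀² + a²`, `z = 0`, the line radius at `s = 0` is `r₀`.
[folklore] -/
theorem lineRadius_zero_of_circle (hr₀ : 0 < r₀) (hcirc : p 1 ^ 2 + p 2 ^ 2 = r₀ ^ 2 + a ^ 2)
    (v : E4) : lineRadius a p v 0 = r₀ := by
  simp only [lineRadius, lineCylSq, zero_mul, add_zero, hcirc, add_sub_cancel_right]
  exact Real.sqrt_sq hr₀.le

/-- On the orbit circle the Kerr–Schild radius is `r₀`. [folklore] -/
theorem radius_of_circle (hr₀ : 0 < r₀) (hp3 : p 3 = 0)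
    (hcirc : p 1 ^ 2 + p 2 ^ 2 = r₀ ^ 2 + a ^ 2) : radius a p = r₀ := by
  have ha : a ^ 2 < p 1 ^ 2 + p 2 ^ 2 := by rw [hcirc]; nlinarith
  rw [radius_of_apply_three_eq_zero hp3 ha, hcirc, add_sub_cancel_right]
  exact Real.sqrt_sq hr₀.le

/-- **The geodesic equation of the photon orbit, pointwise**: at a point `p` of the exterior with
`z = 0` and `x² + y² = r₀² + a²`, with `q² r₀³ = M`, the acceleration `−q²(x ∂_x + y ∂_y)` and the
Christoffel map of the Kerr–Schild components on the velocity `w = (1 − aq) ∂_t + q y ∂_x − q x ∂_y`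
cancel: `c'' + Γ(c', c') = 0`. The four components `2 g(c'', ∂_μ) + 2 ∂_{c'} g(c', ∂_μ) −
∂_μ g(c', c') = 0` are rational identities in `x, y, r₀, a, q` (module docstring).
[cite: Sbierski2015, §7A] -/
theorem christoffel_orbitVel [Facts] (hr₀ : 0 < r₀) (hq : q ^ 2 * r₀ ^ 3 = M)
    (hp : p ∈ region a (rPlus M a)) (hp3 : p 3 = 0)
    (hcirc : p 1 ^ 2 + p 2 ^ 2 = r₀ ^ 2 + a ^ 2) :
    orbitAcc q p + OpensChart.christoffel (smoothMetric M a (rPlus M a)).toPseudoRiemannianMetric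
      (bilin M a) ⟨p, hp⟩ (orbitVel a q p) (orbitVel a q p) = 0 := by
  set w := orbitVel a q p with hw_def
  set V := orbitAcc q p + OpensChart.christoffel
    (smoothMetric M a (rPlus M a)).toPseudoRiemannianMetric (bilin M a) ⟨p, hp⟩ w w with hV_def
  have hx : 0 < radius a p := radius_pos_of_mem_region hp
  have hd : DifferentiableAt ℝ (bilin M a) p := differentiableAt_bilin M a ⟨p, hp⟩
  have ha' : a ^ 2 < p 1 ^ 2 + p 2 ^ 2 := by rw [hcirc]; nlinarith
  have hD : p 1 ^ 2 + p 2 ^ 2 ≠ 0 := by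
    have := sq_nonneg a; exact (this.trans_lt ha').ne'
  have hw3 : w 3 = 0 := orbitVel_apply_three a q p
  have hrad : radius a p = r₀ := radius_of_circle hr₀ hp3 hcirc
  have hlr : ∀ v : E4, lineRadius a p v 0 = r₀ := lineRadius_zero_of_circle hr₀ hcirc
  -- the Christoffel term through the Koszul form
  have hΓ : ∀ Z : E4, 2 * bilin M a p V Z = 2 * bilin M a p (orbitAcc q p) Z +
      (fderiv ℝ (bilin M a) p w w Z + fderiv ℝ (bilin M a) p w w Z -
        fderiv ℝ (bilin M a) p Z w w) := by
    intro Z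
    have h2 := OpensChart.two_mul_val_christoffel
      (g := (smoothMetric M a (rPlus M a)).toPseudoRiemannianMetric) (G := bilin M a) ⟨p, hp⟩ w w Z
    rw [OpensChart.koszulForm_apply, fderiv_bilin_symm M a hd w Z w] at h2
    rw [hV_def, map_add, add_apply, mul_add, ← h2]
    rfl
  -- the directional derivatives along `w`, `∂_x`, `∂_y`; `∂_t G = 0`, `∂_z G(w, w) = 0`
  have hA := fun Z : E4 ↦ fderiv_bilin_apply_eq_of_hasDerivAt hd
    (hasDerivAt_bilin_line hp3 hw3 ha' w Z (hasDerivAt_lineBilin (M := M) ha' w Z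
      (hasDerivAt_lineEll ha' w) (hasDerivAt_lineEll ha' Z)))
  have hB1 := fderiv_bilin_apply_eq_of_hasDerivAt hd
    (hasDerivAt_bilin_line hp3 (by simp) ha' w w
      (hasDerivAt_lineBilin (M := M) (v := E4.basisVector 1) ha' w w
        (hasDerivAt_lineEll ha' w) (hasDerivAt_lineEll ha' w)))
  have hB2 := fderiv_bilin_apply_eq_of_hasDerivAt hd
    (hasDerivAt_bilin_line hp3 (by simp) ha' w w
      (hasDerivAt_lineBilin (M := M) (v := E4.basisVector 2) ha' w w
        (hasDerivAt_lineEll ha' w) (hasDerivAt_lineEll ha' w)))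
  have hB0 : fderiv ℝ (bilin M a) p (E4.basisVector 0) w w = 0 := by
    rw [fderiv_bilin_basisVector_zero M a hd]; rfl
  have hB3 : fderiv ℝ (bilin M a) p (E4.basisVector 3) w w = 0 :=
    fderiv_bilin_basisVector_three_eq_zero M a hp3 hw3 hd
  -- the value of `g_p(c'', ∂_μ)`
  have hacc := fun Z : E4 ↦ bilin_apply_of_apply_three_eq_zero M hp3 ha' (orbitAcc q p) Z
  -- the four components vanish
  have hcomp : ∀ μ : Fin 4, bilin M a p V (E4.basisVector μ) = 0 := by
    intro μ
    have h := hΓ (E4.basisVector μ)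
    suffices hs : 2 * bilin M a p V (E4.basisVector μ) = 0 by linarith
    rw [h, hA, hacc]
    fin_cases μ
    · simp only [Fin.zero_eta, Fin.isValue, hB0]
      simp only [lineEll_zero, hlr, hrad, Minkowski.bilin_apply, Fin.sum_univ_three,
        Fin.succ_zero_eq_one, Fin.succ_one_eq_two, Fin.reduceSucc, PiLp.single_apply,
        Fin.reduceEq, if_true, if_false, hw_def, orbitVel_apply_zero, orbitVel_apply_one,
        orbitVel_apply_two, orbitAcc_apply_zero, orbitAcc_apply_one, orbitAcc_apply_two,
        orbitAcc_apply_three, ← hq]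
      field_simp
      ring
    · simp only [Fin.mk_one, Fin.isValue, hB1]
      simp only [lineEll_zero, hlr, hrad, Minkowski.bilin_apply, Fin.sum_univ_three,
        Fin.succ_zero_eq_one, Fin.succ_one_eq_two, Fin.reduceSucc, PiLp.single_apply,
        Fin.reduceEq, if_true, if_false, hw_def, orbitVel_apply_zero, orbitVel_apply_one,
        orbitVel_apply_two, orbitAcc_apply_zero, orbitAcc_apply_one, orbitAcc_apply_two,
        orbitAcc_apply_three, ← hq]
      field_simp
      ring
    · simp only [Fin.reduceFinMk, Fin.isValue, hB2]
      simp only [lineEll_zero, hlr, hrad, Minkowski.bilin_apply, Fin.sum_univ_three,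
        Fin.succ_zero_eq_one, Fin.succ_one_eq_two, Fin.reduceSucc, PiLp.single_apply,
        Fin.reduceEq, if_true, if_false, hw_def, orbitVel_apply_zero, orbitVel_apply_one,
        orbitVel_apply_two, orbitAcc_apply_zero, orbitAcc_apply_one, orbitAcc_apply_two,
        orbitAcc_apply_three, ← hq]
      field_simp
      ring
    · simp only [Fin.reduceFinMk, Fin.isValue, hB3]
      simp only [lineEll_zero, hlr, hrad, Minkowski.bilin_apply, Fin.sum_univ_three,
        Fin.succ_zero_eq_one, Fin.succ_one_eq_two, Fin.reduceSucc, PiLp.single_apply,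
        Fin.reduceEq, if_true, if_false, hw_def, orbitVel_apply_zero, orbitVel_apply_one,
        orbitVel_apply_two, orbitAcc_apply_zero, orbitAcc_apply_one, orbitAcc_apply_two,
        orbitAcc_apply_three, ← hq]
      field_simp
      ring
  -- nondegeneracy
  refine bilin_nondegenerate M a hx V fun Z ↦ ?_
  rw [eq_sum_basisVector Z, map_sum]
  refine Finset.sum_eq_zero fun μ _ ↦ ?_
  rw [map_smul, smul_eq_mul, hcomp μ, mul_zero]

end Point

end Kerr

end Literature.Geometry.Lorentzian

end
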